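import Literature.Topology.FourManifolds.BasinPairConj
import Literature.Topology.FourManifolds.BasinExtension
import HarnessLib

/-!
# Pre-extension maps of a pair of basin settings: the cone structure at the minimum and the
# diffeomorphism of the sphere of directions

Topic `Literature/Topology/FourManifolds` (support file for the two-field handle-extension
endgame of `stmt-SmoothPoincare4-15190`; the two-field analogue of `BasinCone.lean`,
`BasinSphere.lean`).  Everything here is **proved**; the new definitions are bookkeeping.

For a pair of basin settings `P : BasinPair g ξ_A ξ_B` (same Morse function, same minimum `p₀`,
same radial chart at `p₀`) and a boundary map `χ`, a **pre-extension half**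
`E : P.PreHalf χ` is a self-map `ψ` of `W` which, strictly between the minimum level and `hi`,
preserves `g` and is smooth, fixes `p₀`, **commutes with the scalings of the chart ball at `p₀`**
(cone law) and **is the transport of `χ` on the level `L`** — the abstract form of the glued map
`psi0` of `PairPsi.lean` (level conjugation along the two flows plus model conjugations at the
saddles).  As in the one-field case:

* `PreHalf.coneFun E v = toChart (ψ (ofChart v))` — the chart expression of `ψ` near `p₀`:
  norm-preserving, homogeneous of degree one for factors in `(0, 1]`, smooth off the apex, and
  inverted by the cone map of an inverse half `E' : P.swap.PreHalf χ'`;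
* `PreHalf.sphereMap`, `PreHalf.sphereDiffeo` — the induced map of the sphere of directions and,
  for a pair of mutually inverse halves, the induced diffeomorphism of the sphere.

## References

* H. B. Griffiths, *Automorphisms of a 3-dimensional handlebody*, Abh. Math. Sem. Univ. Hamburg
  26 (1964), §§3–6. [GriffithsHB1964Handlebody]
* J. Milnor, *Lectures on the h-cobordism theorem* (1965), Def. 3.1, Thm. 4.1. [MilnorHCobordism1965]
-/

open scoped Manifold ContDiff Topology
open Set Function Filter Metric

noncomputable section

namespace Literature.Topology.FourManifolds

open Cobordism FourManifolds.Flow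

universe u

variable {n : ℕ} {W : Type u} [TopologicalSpace W] [T2Space W] [SecondCountableTopology W]
  [CompactSpace W] [ChartedSpace (EuclideanHalfSpace (n + 1)) W] [IsManifold (𝓡∂ (n + 1)) ∞ W]
  [Nonempty (BoundaryManifold.boundaryData n W).carrier]

namespace BasinPair

attribute [local instance] fact_finrank_euclideanSpace_succ

variable {g : W → ℝ} {ξA ξB : Π x : W, TangentSpace (𝓡∂ (n + 1)) x} (P : BasinPair g ξA ξB)

/-- **A pre-extension half** of a pair of basin settings for the boundary map `χ`: a self-map of
`W` which between the minimum level and `hi` preserves `g` and is smooth, fixes `p₀`, commutes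
with the scalings of the chart ball at `p₀`, and is the transport of `χ` on the level `L`. [cite: GriffithsHB1964Handlebody, §§3–6] -/
structure PreHalf (χ : (𝓡∂ (n + 1)).boundary W → (𝓡∂ (n + 1)).boundary W) where
  /-- the map -/
  ψ : W → W
  /-- it preserves the levels strictly between the minimum and `hi` -/
  apply_ψ : ∀ x, g x ∈ Ioo (g P.A.p₀) P.A.hi → g (ψ x) = g x
  /-- it fixes the minimum -/
  ψ_p₀ : ψ P.A.p₀ = P.A.p₀
  /-- it is smooth strictly between the minimum and `hi` -/
  contMDiffAt_ψ : ∀ x, g x ∈ Ioo (g P.A.p₀) P.A.hi → ContMDiffAt (𝓡∂ (n + 1)) (𝓡∂ (n + 1)) ∞ ψ x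
  /-- the cone law in the chart ball at `p₀` -/
  ψ_smul : ∀ v : EuclideanSpace ℝ (Fin (n + 1)), ‖v‖ < P.A.r₀ → v ≠ 0 → ∀ s : ℝ, 0 < s → s ≤ 1 →
    ψ (P.A.ofChart (s • v)) = P.A.ofChart (s • P.A.toChart (ψ (P.A.ofChart v)))
  /-- on the level `L` it is the transport of `χ` -/
  ψ_L : ∀ w, g w = P.A.L → ψ w = P.transportAB χ w

namespace PreHalf

variable {P}
variable {χ χ' : (𝓡∂ (n + 1)).boundary W → (𝓡∂ (n + 1)).boundary W} (E : P.PreHalf χ)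

/-! ### Levels near `p₀` -/

omit [Nonempty (BoundaryManifold.boundaryData n W).carrier] in
/-- A point of the open chart ball other than the apex has level in `(g p₀, hi)`. [folklore] -/
theorem apply_ofChart_mem_Ioo {v : EuclideanSpace ℝ (Fin (n + 1))} (hv : ‖v‖ < P.A.r₀) (hv0 : v ≠ 0) :
    g (P.A.ofChart v) ∈ Ioo (g P.A.p₀) P.A.hi := by
  refine ⟨?_, (P.A.apply_ofChart_lt_sph hv).trans (P.A.sph_lt_L.trans P.A.L_lt_hi)⟩
  rw [P.A.apply_ofChart hv.le]
  exact lt_add_of_pos_right _ (by positivity)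

omit [Nonempty (BoundaryManifold.boundaryData n W).carrier] in
/-- A point with `g p₀ < g x < sph` is `ofChart` of a nonzero small vector. [folklore] -/
theorem toChart_ne_zero {x : W} (hx : g P.A.p₀ < g x) (hxs : g x ≤ P.A.sph) : P.A.toChart x ≠ 0 := fun h => by
  have h1 := P.A.norm_toChart_sq hxs
  rw [h, norm_zero] at h1
  linarith

/-- `ψ` maps `{g < sph} ∖ {p₀}`-levels: `g (ψ x) < sph` for `g p₀ < g x < sph`. [folklore] -/
theorem apply_ψ_lt_sph {x : W} (hx : g P.A.p₀ < g x) (hxs : g x < P.A.sph) : g (E.ψ x) < P.A.sph := by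
  rw [E.apply_ψ x ⟨hx, hxs.trans (P.A.sph_lt_L.trans P.A.L_lt_hi)⟩]; exact hxs

/-! ### The cone map -/

/-- **The chart expression of `ψ` near `p₀`**: `v ↦ toChart (ψ (ofChart v))`. [cite: GriffithsHB1964Handlebody, §§3–6] -/
def coneFun (v : EuclideanSpace ℝ (Fin (n + 1))) : EuclideanSpace ℝ (Fin (n + 1)) :=
  P.A.toChart (E.ψ (P.A.ofChart v))

/-- Unfolding `coneFun`. [folklore] -/
theorem coneFun_def (v : EuclideanSpace ℝ (Fin (n + 1))) : E.coneFun v = P.A.toChart (E.ψ (P.A.ofChart v)) := rfl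

/-- `coneFun 0 = 0`. [folklore] -/
theorem coneFun_zero : E.coneFun 0 = 0 := by
  rw [coneFun_def, P.A.ofChart_zero, E.ψ_p₀, P.A.toChart_p₀]

/-- **`coneFun` preserves the norm** (`ψ` preserves the levels `g = g p₀ + ‖·‖²`). [folklore] -/
theorem norm_coneFun {v : EuclideanSpace ℝ (Fin (n + 1))} (hv : ‖v‖ < P.A.r₀) : ‖E.coneFun v‖ = ‖v‖ := by
  by_cases hv0 : v = 0
  · rw [hv0, E.coneFun_zero]
  have hx : g (P.A.ofChart v) < P.A.sph := P.A.apply_ofChart_lt_sph hv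
  have hI := apply_ofChart_mem_Ioo hv hv0
  have h1 : ‖E.coneFun v‖ ^ 2 = ‖v‖ ^ 2 := by
    rw [coneFun_def, P.A.norm_toChart_sq (E.apply_ψ_lt_sph hI.1 hx).le, E.apply_ψ _ hI, P.A.apply_ofChart hv.le]
    ring
  exact (pow_left_inj₀ (norm_nonneg _) (norm_nonneg _) two_ne_zero).1 h1

/-- **`coneFun` is homogeneous of degree one** for factors in `(0, 1]`. [cite: GriffithsHB1964Handlebody, §§3–6] -/
theorem coneFun_smul {v : EuclideanSpace ℝ (Fin (n + 1))} (hv : ‖v‖ < P.A.r₀) {s : ℝ} (hs : 0 < s) (hs1 : s ≤ 1) :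
    E.coneFun (s • v) = s • E.coneFun v := by
  by_cases hv0 : v = 0
  · rw [hv0, smul_zero, E.coneFun_zero, smul_zero]
  rw [coneFun_def, E.ψ_smul v hv hv0 s hs hs1, P.A.toChart_ofChart, coneFun_def]
  rw [norm_smul, Real.norm_eq_abs, abs_of_pos hs, ← coneFun_def, E.norm_coneFun hv]
  exact (mul_le_of_le_one_left (norm_nonneg v) hs1).trans hv.le

/-- **The cone map of an inverse half (for the swapped pair) inverts the cone map** on the open
chart ball. [folklore] -/
theorem coneFun_coneFun (E' : P.swap.PreHalf χ') (hinv : ∀ x, g x ∈ Ioo (g P.A.p₀) P.A.hi → E'.ψ (E.ψ x) = x)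
    {v : EuclideanSpace ℝ (Fin (n + 1))} (hv : ‖v‖ < P.A.r₀) : E'.coneFun (E.coneFun v) = v := by
  by_cases hv0 : v = 0
  · rw [hv0, E.coneFun_zero, E'.coneFun_zero]
  have hI := apply_ofChart_mem_Ioo hv hv0
  have hx : g (P.A.ofChart v) < P.A.sph := P.A.apply_ofChart_lt_sph hv
  rw [coneFun_def, coneFun_def, swap_A, P.ofChart_eq, P.toChart_eq,
    P.A.ofChart_toChart_of_apply_le (E.apply_ψ_lt_sph hI.1 hx).le, hinv _ hI, P.A.toChart_ofChart hv.le]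

/-- **`coneFun` is smooth on the punctured open chart ball.** [cite: GriffithsHB1964Handlebody, §§3–6] -/
theorem contMDiffAt_coneFun {v : EuclideanSpace ℝ (Fin (n + 1))} (hv0 : v ≠ 0) (hv : ‖v‖ < P.A.r₀) :
    ContMDiffAt 𝓘(ℝ, EuclideanSpace ℝ (Fin (n + 1))) 𝓘(ℝ, EuclideanSpace ℝ (Fin (n + 1))) ∞ E.coneFun v := by
  have hx : g (P.A.ofChart v) < P.A.sph := P.A.apply_ofChart_lt_sph hv
  have hI := apply_ofChart_mem_Ioo hv hv0
  have hψ := E.contMDiffAt_ψ _ hI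
  have h3 := P.A.contMDiffAt_toChart (P.A.mem_source_of_apply_le (E.apply_ψ_lt_sph hI.1 hx).le)
  exact h3.comp v (hψ.comp v (BasinSetting.contMDiffAt_ofChart hv))

/-! ### The map of the sphere of directions -/

/-- The map of the sphere of directions, as a map into Euclidean space. [cite: GriffithsHB1964Handlebody, §§3–6] -/
def sphereMapFun (u : Metric.sphere (0 : EuclideanSpace ℝ (Fin (n + 1))) 1) : EuclideanSpace ℝ (Fin (n + 1)) :=
  P.A.rad⁻¹ • E.coneFun (P.A.rad • (u : EuclideanSpace ℝ (Fin (n + 1))))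

/-- Unfolding `sphereMapFun`. [folklore] -/
theorem sphereMapFun_apply (u : Metric.sphere (0 : EuclideanSpace ℝ (Fin (n + 1))) 1) :
    E.sphereMapFun u = P.A.rad⁻¹ • E.coneFun (P.A.rad • (u : EuclideanSpace ℝ (Fin (n + 1)))) := rfl

/-- The map of directions takes unit values. [folklore] -/
theorem sphereMapFun_mem (u : Metric.sphere (0 : EuclideanSpace ℝ (Fin (n + 1))) 1) :
    E.sphereMapFun u ∈ Metric.sphere (0 : EuclideanSpace ℝ (Fin (n + 1))) 1 := by
  rw [mem_sphere_zero_iff_norm, sphereMapFun_apply, norm_smul, Real.norm_eq_abs, abs_of_pos (inv_pos.2 P.A.rad_pos),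
    E.norm_coneFun (by rw [P.A.norm_rad_smul]; exact P.A.rad_lt_r₀), P.A.norm_rad_smul, inv_mul_cancel₀ P.A.rad_pos.ne']

/-- **The map of the sphere of directions at `p₀`** induced by the half. [cite: GriffithsHB1964Handlebody, §§3–6] -/
def sphereMap : Metric.sphere (0 : EuclideanSpace ℝ (Fin (n + 1))) 1 → Metric.sphere (0 : EuclideanSpace ℝ (Fin (n + 1))) 1 :=
  Set.codRestrict E.sphereMapFun _ E.sphereMapFun_mem

/-- The map of directions in coordinates. [folklore] -/
@[simp] theorem coe_sphereMap (u : Metric.sphere (0 : EuclideanSpace ℝ (Fin (n + 1))) 1) :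
    ((E.sphereMap u : Metric.sphere (0 : EuclideanSpace ℝ (Fin (n + 1))) 1) : EuclideanSpace ℝ (Fin (n + 1))) =
      P.A.rad⁻¹ • E.coneFun (P.A.rad • (u : EuclideanSpace ℝ (Fin (n + 1)))) := rfl

/-- **The cone map is the cone over the map of directions**: `coneFun (t • u) = t • sphereMap u`
for `0 < t ≤ rad`. [cite: GriffithsHB1964Handlebody, §§3–6] -/
theorem coneFun_smul_coe {t : ℝ} (ht0 : 0 < t) (ht : t ≤ P.A.rad) (u : Metric.sphere (0 : EuclideanSpace ℝ (Fin (n + 1))) 1) :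
    E.coneFun (t • (u : EuclideanSpace ℝ (Fin (n + 1)))) =
      t • ((E.sphereMap u : Metric.sphere (0 : EuclideanSpace ℝ (Fin (n + 1))) 1) : EuclideanSpace ℝ (Fin (n + 1))) := by
  have hs : 0 < t / P.A.rad := div_pos ht0 P.A.rad_pos
  have hs1 : t / P.A.rad ≤ 1 := (div_le_one P.A.rad_pos).2 ht
  have h1 : t • (u : EuclideanSpace ℝ (Fin (n + 1))) = (t / P.A.rad) • (P.A.rad • (u : EuclideanSpace ℝ (Fin (n + 1)))) := by
    rw [smul_smul, div_mul_cancel₀ t P.A.rad_pos.ne']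
  rw [h1, E.coneFun_smul (by rw [P.A.norm_rad_smul]; exact P.A.rad_lt_r₀) hs hs1, coe_sphereMap, smul_smul, div_eq_mul_inv]

omit [Nonempty (BoundaryManifold.boundaryData n W).carrier] in
/-- `rad` of the swapped pair is `rad`. [folklore] -/
theorem rad_swap : P.swap.A.rad = P.A.rad := by
  show P.B.rad = P.A.rad
  unfold BasinSetting.rad; rw [P.r₀_eq]

/-- The cone map of a half of the swapped pair, in the charts of `A`. [folklore] -/
theorem coneFun_swap_def (E' : P.swap.PreHalf χ') (v : EuclideanSpace ℝ (Fin (n + 1))) :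
    E'.coneFun v = P.A.toChart (E'.ψ (P.A.ofChart v)) := by
  rw [coneFun_def, swap_A, P.ofChart_eq, P.toChart_eq]

/-- **The map of directions of an inverse half inverts the map of directions.** [folklore] -/
theorem sphereMap_sphereMap (E' : P.swap.PreHalf χ') (hinv : ∀ x, g x ∈ Ioo (g P.A.p₀) P.A.hi → E'.ψ (E.ψ x) = x)
    (u : Metric.sphere (0 : EuclideanSpace ℝ (Fin (n + 1))) 1) : E'.sphereMap (E.sphereMap u) = u := by
  apply Subtype.ext
  rw [coe_sphereMap, coe_sphereMap, rad_swap, smul_smul, mul_inv_cancel₀ P.A.rad_pos.ne', one_smul,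
    E.coneFun_coneFun E' hinv (by rw [P.A.norm_rad_smul]; exact P.A.rad_lt_r₀), smul_smul,
    inv_mul_cancel₀ P.A.rad_pos.ne', one_smul]

/-- **The map of directions is smooth.** [cite: GriffithsHB1964Handlebody, §§3–6] -/
theorem contMDiff_sphereMap : ContMDiff (𝓡 n) (𝓡 n) ∞ E.sphereMap := by
  have h1 : ContMDiff (𝓡 n) 𝓘(ℝ, EuclideanSpace ℝ (Fin (n + 1))) ∞ E.sphereMapFun := by
    intro u
    have hu0 : P.A.rad • (u : EuclideanSpace ℝ (Fin (n + 1))) ≠ 0 :=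
      smul_ne_zero P.A.rad_pos.ne' (ne_zero_of_mem_unit_sphere u)
    have hcone := E.contMDiffAt_coneFun hu0 (by rw [P.A.norm_rad_smul]; exact P.A.rad_lt_r₀)
    have h2 : ContMDiffAt (𝓡 n) 𝓘(ℝ, EuclideanSpace ℝ (Fin (n + 1))) ∞
        (fun u : Metric.sphere (0 : EuclideanSpace ℝ (Fin (n + 1))) 1 => P.A.rad • (u : EuclideanSpace ℝ (Fin (n + 1)))) u :=
      ((contDiff_const_smul P.A.rad).contMDiff.comp contMDiff_coe_sphere).contMDiffAt
    have h3 : ContMDiffAt (𝓡 n) 𝓘(ℝ, EuclideanSpace ℝ (Fin (n + 1))) ∞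
        (E.coneFun ∘ fun u : Metric.sphere (0 : EuclideanSpace ℝ (Fin (n + 1))) 1 =>
          P.A.rad • (u : EuclideanSpace ℝ (Fin (n + 1)))) u := hcone.comp u h2
    have h4 : ContMDiffAt (𝓡 n) 𝓘(ℝ, EuclideanSpace ℝ (Fin (n + 1))) ∞
        ((fun w : EuclideanSpace ℝ (Fin (n + 1)) => P.A.rad⁻¹ • w) ∘ (E.coneFun ∘
          fun u : Metric.sphere (0 : EuclideanSpace ℝ (Fin (n + 1))) 1 =>
            P.A.rad • (u : EuclideanSpace ℝ (Fin (n + 1))))) u :=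
      (contDiff_const_smul P.A.rad⁻¹).contMDiff.contMDiffAt.comp u h3
    exact h4
  exact h1.codRestrict_sphere _

/-- **The diffeomorphism of the sphere of directions** induced by a pair of mutually inverse
halves. [cite: GriffithsHB1964Handlebody, §§3–6] -/
def sphereDiffeo (E' : P.swap.PreHalf χ') (hinv : ∀ x, g x ∈ Ioo (g P.A.p₀) P.A.hi → E'.ψ (E.ψ x) = x)
    (hinv' : ∀ y, g y ∈ Ioo (g P.swap.A.p₀) P.swap.A.hi → E.ψ (E'.ψ y) = y) :
    Metric.sphere (0 : EuclideanSpace ℝ (Fin (n + 1))) 1 ≃ₘ⟮𝓡 n, 𝓡 n⟯ Metric.sphere (0 : EuclideanSpace ℝ (Fin (n + 1))) 1 where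
  toFun := E.sphereMap
  invFun := E'.sphereMap
  left_inv := E.sphereMap_sphereMap E' hinv
  right_inv := E'.sphereMap_sphereMap E hinv'
  contMDiff_toFun := E.contMDiff_sphereMap
  contMDiff_invFun := E'.contMDiff_sphereMap

/-- The diffeomorphism of directions in coordinates. [folklore] -/
theorem coe_sphereDiffeo (E' : P.swap.PreHalf χ') (hinv : ∀ x, g x ∈ Ioo (g P.A.p₀) P.A.hi → E'.ψ (E.ψ x) = x)
    (hinv' : ∀ y, g y ∈ Ioo (g P.swap.A.p₀) P.swap.A.hi → E.ψ (E'.ψ y) = y)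
    (u : Metric.sphere (0 : EuclideanSpace ℝ (Fin (n + 1))) 1) : E.sphereDiffeo E' hinv hinv' u = E.sphereMap u := rfl

/-- The inverse of the diffeomorphism of directions in coordinates. [folklore] -/
theorem sphereDiffeo_symm_apply (E' : P.swap.PreHalf χ') (hinv : ∀ x, g x ∈ Ioo (g P.A.p₀) P.A.hi → E'.ψ (E.ψ x) = x)
    (hinv' : ∀ y, g y ∈ Ioo (g P.swap.A.p₀) P.swap.A.hi → E.ψ (E'.ψ y) = y)
    (u : Metric.sphere (0 : EuclideanSpace ℝ (Fin (n + 1))) 1) : (E.sphereDiffeo E' hinv hinv').symm u = E'.sphereMap u := rfl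

end PreHalf

end BasinPair

end Literature.Topology.FourManifolds
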